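import Mathlib

/-!
# Route `SignedLowerHalves`, crux `KobayashiLowerHalfSemistable` (item stmt-BirchSwinnertonDyer-19000): the
# MODULE ALGEBRA of bstw-MEMO-10's reduction (3-ii)♭ → (3-ii)♭′ — Lemma IDX, Lemma A (rank-one index
# transfer) and the robust ONE-BIT lattice computation behind BSTW I Prop. 3.11
# (cell `bsd-ssimc`, seat `bsd-ssimc-k3-c2` gen 10, object «IDX-ONEBIT», planner ruling D21-11;
# a `--supports stmt-BirchSwinnertonDyer-19000 --as helper` file: closes nothing)

PARTITION (cell bsd-ssimc): X6 ∧ r = 0 (A6) × the 12 cells at `p = 3` + X6 r1 @ 3 + D2 literal @ 3 —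
types-the-object-of (the commutative algebra inside the cell's reduction of the `p = 3` residual of
Burungale–Skinner–Tian–Wan, arXiv:2409.01350 (BSTW), Part I Thm. 1.3 on semistable curves); closes NONE;
nothing booked. HONEST FRAMING: pure commutative algebra (module theory over a commutative domain, Mathlib
notions only, sorry-free); NOT (3-ii)♭′, NOT B1, NOT a binder, NO tier change; crux 2 kernel state p441716
(`KobayashiLowerHalfSemistable_of_tiersS_S3`) unchanged; nothing about modular curves, Hida families or
elliptic curves is asserted; BSD is not proved by any of this.

Source: `run/shared/lean/pub/bsd-ssimc/bstw-MEMO-10.md` (sha16 56db55b328bab2c5) §3 (Lemma A, Lemma IDX,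
(3.3)) and §4 (lattices `L_ε`, "robust form"). SYMBOL DICTIONARY (memo ↔ this file, one-to-one):
`Λ = Λ_L^v` (§3) resp. `ℚ̄_p⟦X⟧` (§4) ↔ `R`, any commutative domain · `T_v` ↔ `t`, `X` ↔ `X` ·
torsion-free ambient modules `D(ℍ̃⁻) ⊗ Frac`, `Ĩ ⊗ Frac` ↔ `V`, `M` · `η′` ↔ `f : V →ₗ[R] M` · `Ĩ`, `Ĩ^cusp = T_v Ĩ`
↔ `J`, `t • J` · `ℍ̃`, `𝕋̃`, `ℍ_v` ↔ `H`, `T`, `Hv` (submodules), `ℍ̃⁻ = ℍ̃/ℍ_v` ↔ `H ⧸ Hv` with a given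
`b : H ⧸ Hv ≃ R` (free of rank one), `im j` ↔ `T.map Hv.mkQ`, the line `ℓ` ↔ `ℓ` · `L_ε = ⟨h, ẽ₁, ẽ₂⟩` ↔
`R × R × R` with `h = (1,0,0)`, `ẽ₁ = (0,1,0)`, `ẽ₂ = (0,0,1)` · `ε = (ε₁, ε₂) ∈ {0,1}²` ↔ `ε₁ ε₂ : R` with
`ε_i = 0 ∨ ε_i = 1` · the generators `X ẽ_i + ε_i h` of `𝔞L_ε` ↔ `(ε₁, X, 0)`, `(ε₂, 0, X)` · `𝔞L_ε`
(`𝔞 = ker λ_{𝐡_v}`) ↔ `N`, ANY submodule with `N ≤ ker φ_ε` containing `b • (ε₁, X, 0)`, `b • (ε₂, 0, X)` for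
one `b ≠ 0` (under (m3′) `N` is their span, `b = 1`; a joint image `J ⊇ (X^n)²` gives `b = X^(n-1)`) · `φ_ε` ↔
`φ` with `hφ : φ (x₀,x₁,x₂) = X x₀ − ε₁ x₁ − ε₂ x₂` = the coordinate of the line `(L_ε/𝔞L_ε) ⊗ ℚ̄_p((X))`
normalised by `h̄ ↦ X` (memo: `ē_i = −ε_i h̄/X`) · `F_ε` (torsion-free quotient of `L_ε/𝔞L_ε`) ↔
`((R × R × R) ⧸ N) ⧸ torsion` · `I_ε` ↔ `Ideal.span {X, ε₁, ε₂} = range φ_ε`.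

WHAT IS KERNEL-CHECKED. (a) **Lemma IDX** `eq_of_smul_eq_smul` (+ `le_of_smul_le_smul`,
`map_eq_of_map_smul_eq`, `range_eq_of_map_smul_top_eq` = the step `η′(D(ℍ̃⁻)) = Ĩ` of (3.3)). (b) **Lemma A**:
case (iii) `map_mkQ_eq_smul_top_of_quotient_equiv` (the only submodule of a free rank-one module with
quotient `≃ Λ/(t)` is `t ·` the module — annihilators + third isomorphism theorem); case (iv)
`smul_inf_eq_smul_inf_of_saturated`, `map_mkQ_smul_top`. (c) **§4 robust one-bit form**, J-free: abstractly
`ker_liftQ_eq_torsion` (if `N ≤ ker φ` and one `b ≠ 0` multiplies `ker φ` into `N`, the torsion of `L/N` is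
exactly the kernel of the induced functional), hence `F ≃ range φ`, `[x] ↦ φ x`
(`exists_torsionFreeQuotient_equiv_range`); concretely `exists_torsionFreeQuotient_equiv_span`
(`F_ε ≃ I_ε`, `[h] ↦ X`), and the module form of THE BIT: `exists_equiv_h_eq_one` (`ε = (0,0)`: `F_ε ≃ Λ`,
`[h] ↦ 1`, saturated), `exists_equiv_h_eq_X` (`ε ≠ (0,0)`: `F_ε ≃ Λ`, `[h] ↦ X` — BSTW I Prop. 3.11's
display "image of `𝕋̂⁻_P` = `X · ℚ̄_p⟦X⟧`"), `span_h_eq_top_iff` (`[h]` generates `F_ε` ⟺ `ε = (0,0)`, for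
`X` a non-unit), `span_h_eq_smul_top_of_ne_zero` (index exactly `(X)` otherwise) = MEMO-10 (C4). The torsion
LENGTHS (`Λ ⊕ Λ/X` vs `Λ ⊕ (Λ/X)²`) are not used downstream (memo §4) and are not formalised.
References: BSTW arXiv:2409.01350v2 I Props. 3.11/3.13, Lemma 3.16, Thm. 3.22, §4.3.3; Kings–Loeffler–Zerbes,
Camb. J. Math. 5 (2017) Prop. 10.1.1. Design: THEOREMS ONLY (no def/structure/instance/notation/named fact).
-/

open Pointwise

-- lint debt, justified: the Theorems namespace repeats the summit name (D-0017); `dupNamespace` flags every decl.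
set_option linter.dupNamespace false

namespace Summit.BirchSwinnertonDyer.BirchSwinnertonDyer.Theorems.IndexTransfer

/-! ## Lemma IDX (MEMO-10 §3) -/

section IDX

variable {R : Type*} [CommRing R] [IsDomain R]
  {M : Type*} [AddCommGroup M] [Module R M] [Module.IsTorsionFree R M]

/-- **Lemma IDX, one inclusion.** Over a domain, on a torsion-free module: `t ≠ 0` and `t • N ≤ t • N'`
(pointwise multiples) give `N ≤ N'` — from `t • x = t • n'` cancel `t`. (bstw-MEMO-10 §3.) -/
theorem le_of_smul_le_smul {t : R} (ht : t ≠ 0) {N N' : Submodule R M} (h : t • N ≤ t • N') :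
    N ≤ N' := by
  intro x hx
  have hx' : t • x ∈ t • N' := h (Submodule.smul_mem_pointwise_smul x t N hx)
  obtain ⟨y, hy, hyx⟩ := (Submodule.mem_smul_pointwise_iff_exists (t • x) t N').1 hx'
  have hyx' : y = x := (IsRegular.of_ne_zero ht).smul_right_injective M hyx
  exact hyx' ▸ hy

/-- **Lemma IDX.** Over a domain, on a torsion-free module: `t ≠ 0` and `t • N = t • N'` imply `N = N'`
(bstw-MEMO-10 §3: "`x ∈ N ⇒ tx = tn′ ⇒ x = n′`"). -/
theorem eq_of_smul_eq_smul {t : R} (ht : t ≠ 0) {N N' : Submodule R M} (h : t • N = t • N') :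
    N = N' :=
  le_antisymm (le_of_smul_le_smul ht h.le) (le_of_smul_le_smul ht h.ge)

/-- **Lemma IDX, corollary.** For `f : V → M` linear into a torsion-free module over a domain, `t ≠ 0`
and `f(t • B) = t • J` imply `f(B) = J` (bstw-MEMO-10 §3, the "Consequently" clause). -/
theorem map_eq_of_map_smul_eq {V : Type*} [AddCommGroup V] [Module R V] (f : V →ₗ[R] M) {t : R}
    (ht : t ≠ 0) {B : Submodule R V} {J : Submodule R M} (h : (t • B).map f = t • J) :
    B.map f = J := by
  rw [Submodule.map_pointwise_smul] at h
  exact eq_of_smul_eq_smul ht h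

/-- **Lemma IDX, corollary, whole-module form = MEMO-10 (3.3).** With `V = D(ℍ̃⁻) (⊗ Frac)`, `f = η′`,
`t = T_v`, `t • V = D(j)(D(𝕋̃⁻))` (Lemma A) and `f(t • V) = Ĩ^cusp = T_v • Ĩ` (BSTW I Thm. 3.22):
`range η′ = Ĩ`. -/
theorem range_eq_of_map_smul_top_eq {V : Type*} [AddCommGroup V] [Module R V] (f : V →ₗ[R] M)
    {t : R} (ht : t ≠ 0) {J : Submodule R M} (h : (t • (⊤ : Submodule R V)).map f = t • J) :
    LinearMap.range f = J := by
  rw [← Submodule.map_top]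
  exact map_eq_of_map_smul_eq f ht h

end IDX

/-! ## Lemma A (MEMO-10 §3): rank-one index transfer -/

section RankOne

variable {R : Type*} [CommRing R]

/-- If `R ⧸ I ≃ R ⧸ (t)` as `R`-modules then `I = (t)`: both are the annihilator of the quotient. -/
theorem ideal_eq_span_singleton_of_quotient_equiv {I : Ideal R} {t : R}
    (e : (R ⧸ I) ≃ₗ[R] (R ⧸ Ideal.span {t})) : I = Ideal.span {t} := by
  have h := e.annihilator_eq
  rwa [Ideal.annihilator_quotient, Ideal.annihilator_quotient] at h

/-- `t • R = (t)` as submodules of `R`. -/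
theorem smul_top_eq_span_singleton (t : R) :
    t • (⊤ : Submodule R R) = (Ideal.span {t} : Submodule R R) := by
  rw [← Submodule.ideal_span_singleton_smul, Ideal.smul_eq_mul, Ideal.mul_top]

/-- **Lemma A, rank-one step.** In a free rank-one module `F` (`b : F ≃ R` given), a submodule `N` with
`F ⧸ N ≃ R ⧸ (t)` IS `t • F` (bstw-MEMO-10 §3, case (iii): "the only submodule of the free rank-one
`Λ_L^v`-module `ℍ̃⁻` with quotient `Λ/(T_v)` is `T_v · ℍ̃⁻`"). -/
theorem eq_smul_top_of_quotient_equiv {F : Type*} [AddCommGroup F] [Module R F] (b : F ≃ₗ[R] R)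
    {N : Submodule R F} {t : R} (e : (F ⧸ N) ≃ₗ[R] (R ⧸ Ideal.span {t})) :
    N = t • (⊤ : Submodule R F) := by
  have e' : (R ⧸ N.map (b : F →ₗ[R] R)) ≃ₗ[R] (R ⧸ Ideal.span {t}) :=
    (Submodule.Quotient.equiv N (N.map (b : F →ₗ[R] R)) b rfl).symm.trans e
  have hI : N.map (b : F →ₗ[R] R) = Ideal.span {t} := ideal_eq_span_singleton_of_quotient_equiv e'
  have hN : N = (N.map (b : F →ₗ[R] R)).map (b.symm : R →ₗ[R] F) := by
    rw [← Submodule.map_comp]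
    simp
  rw [hN, hI, ← smul_top_eq_span_singleton, Submodule.map_pointwise_smul, Submodule.map_top,
    LinearEquiv.range]

/-- **Lemma A, case (iii), assembled.** `Hv ≤ T ≤ H` (`ℍ_v = 𝕋_v ⊆ 𝕋̃ ⊆ ℍ̃`, by Prop. 3.13 (i) and
`𝕋⁺ = ℍ⁺`), `H ⧸ Hv` free of rank one (`ℍ̃⁻`), `H ⧸ T ≃ R ⧸ (t)` (`ℍ̃/𝕋̃ ≃ Λ/T_v`, Prop. 3.13 (iii)) ⇒
the image of `T` in `H ⧸ Hv` (`= im j`) is `t • (H ⧸ Hv)`: third isomorphism theorem + the rank-one step. -/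
theorem map_mkQ_eq_smul_top_of_quotient_equiv {H : Type*} [AddCommGroup H] [Module R H]
    {T Hv : Submodule R H} (hvT : Hv ≤ T) (b : (H ⧸ Hv) ≃ₗ[R] R) {t : R}
    (e : (H ⧸ T) ≃ₗ[R] (R ⧸ Ideal.span {t})) :
    T.map Hv.mkQ = t • (⊤ : Submodule R (H ⧸ Hv)) :=
  eq_smul_top_of_quotient_equiv b ((Submodule.quotientQuotientEquivQuotient Hv T hvT).trans e)

/-- **Lemma A, case (iv), first step.** If `ℓ` is `t`-saturated in `V` (`t • y ∈ ℓ ⇒ y ∈ ℓ`; a line of the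
ambient `Frac(Λ)`-space is) then `t • H ⊓ ℓ = t • (H ⊓ ℓ)` ("`𝕋_v = T_v ℍ̃ ∩ ℓ = T_v (ℍ̃ ∩ ℓ) = T_v ℍ_v`",
bstw-MEMO-10 §3). No domain hypothesis needed. -/
theorem smul_inf_eq_smul_inf_of_saturated {V : Type*} [AddCommGroup V] [Module R V] (t : R)
    (H ℓ : Submodule R V) (hℓ : ∀ y : V, t • y ∈ ℓ → y ∈ ℓ) :
    (t • H) ⊓ ℓ = t • (H ⊓ ℓ) := by
  apply le_antisymm
  · rintro x ⟨hxH, hxℓ⟩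
    obtain ⟨y, hy, rfl⟩ := (Submodule.mem_smul_pointwise_iff_exists x t H).1 hxH
    exact Submodule.smul_mem_pointwise_smul y t (H ⊓ ℓ) ⟨hy, hℓ y hxℓ⟩
  · intro x hx
    obtain ⟨y, ⟨hyH, hyℓ⟩, rfl⟩ := (Submodule.mem_smul_pointwise_iff_exists x t (H ⊓ ℓ)).1 hx
    exact ⟨Submodule.smul_mem_pointwise_smul y t H hyH, ℓ.smul_mem t hyℓ⟩

/-- **Lemma A, case (iv), second step.** The image of `t • H` in `H ⧸ Hv` is `t • (H ⧸ Hv)`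
("`j(T_v x + T_v ℍ_v) = T_v x + ℍ_v`, so `im j = T_v (ℍ̃/ℍ_v)`", bstw-MEMO-10 §3). -/
theorem map_mkQ_smul_top {H : Type*} [AddCommGroup H] [Module R H] (Hv : Submodule R H) (t : R) :
    (t • (⊤ : Submodule R H)).map Hv.mkQ = t • (⊤ : Submodule R (H ⧸ Hv)) := by
  rw [Submodule.map_pointwise_smul, Submodule.map_top, Submodule.range_mkQ]

end RankOne

/-! ## MEMO-10 §4: the torsion-free quotient of `L/N`, read off one functional -/

section TorsionFreeQuotient

variable {R : Type*} [CommRing R] [IsDomain R] {L : Type*} [AddCommGroup L] [Module R L]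

/-- **Torsion of a quotient by an almost-kernel.** `φ : L → R` linear over a domain, `N ≤ ker φ`, and ONE
`b ≠ 0` multiplies `ker φ` into `N` ⇒ the torsion submodule of `L ⧸ N` is exactly the kernel of the
functional `L ⧸ N → R` induced by `φ` (abstract form of bstw-MEMO-10 §4 "robust form"). -/
theorem ker_liftQ_eq_torsion (φ : L →ₗ[R] R) (N : Submodule R L) (hN : N ≤ LinearMap.ker φ) {b : R}
    (hb : b ≠ 0) (hbN : ∀ x : L, φ x = 0 → b • x ∈ N) :
    LinearMap.ker (N.liftQ φ hN) = Submodule.torsion R (L ⧸ N) := by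
  ext q
  obtain ⟨x, rfl⟩ := N.mkQ_surjective q
  rw [LinearMap.mem_ker, Submodule.mkQ_apply, Submodule.liftQ_apply, Submodule.mem_torsion_iff]
  constructor
  · intro hx
    refine ⟨⟨b, mem_nonZeroDivisors_of_ne_zero hb⟩, ?_⟩
    change b • (Submodule.Quotient.mk x : L ⧸ N) = 0
    rw [← Submodule.Quotient.mk_smul, Submodule.Quotient.mk_eq_zero]
    exact hbN x hx
  · rintro ⟨a, ha⟩
    have ha' : (a : R) • φ x = 0 := by
      have h1 : (a : R) • Submodule.Quotient.mk (p := N) x = 0 := ha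
      rw [← Submodule.Quotient.mk_smul] at h1
      have h2 := congrArg (N.liftQ φ hN) h1
      rw [map_zero, Submodule.liftQ_apply, map_smul] at h2
      exact h2
    rcases smul_eq_zero.1 ha' with h | h
    · exact absurd h (nonZeroDivisors.coe_ne_zero a)
    · exact h

/-- **The torsion-free quotient is the range of the functional**, with tracking: under the hypotheses of
`ker_liftQ_eq_torsion` there is `(L ⧸ N) ⧸ torsion ≃ range φ` sending the class of `x` to `φ x`. -/
theorem exists_torsionFreeQuotient_equiv_range (φ : L →ₗ[R] R) (N : Submodule R L)
    (hN : N ≤ LinearMap.ker φ) {b : R} (hb : b ≠ 0) (hbN : ∀ x : L, φ x = 0 → b • x ∈ N) :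
    ∃ e : ((L ⧸ N) ⧸ Submodule.torsion R (L ⧸ N)) ≃ₗ[R] LinearMap.range φ,
      ∀ x : L, (e (Submodule.Quotient.mk (Submodule.Quotient.mk x)) : R) = φ x := by
  set ψ : (L ⧸ N) →ₗ[R] R := N.liftQ φ hN with hψ
  have hker : LinearMap.ker ψ = Submodule.torsion R (L ⧸ N) := ker_liftQ_eq_torsion φ N hN hb hbN
  set ψ' : ((L ⧸ N) ⧸ Submodule.torsion R (L ⧸ N)) →ₗ[R] R :=
    (Submodule.torsion R (L ⧸ N)).liftQ ψ hker.ge with hψ'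
  have hinj : Function.Injective ψ' := by
    rw [← LinearMap.ker_eq_bot, hψ']
    exact Submodule.ker_liftQ_eq_bot _ _ _ hker.le
  have hrange : LinearMap.range ψ' = LinearMap.range φ := by
    rw [hψ', Submodule.range_liftQ, hψ, Submodule.range_liftQ]
  exact ⟨(LinearEquiv.ofInjective ψ' hinj).trans (LinearEquiv.ofEq _ _ hrange), fun x => rfl⟩

end TorsionFreeQuotient

/-! ## MEMO-10 §4: the lattices `L_ε`, the torsion-free quotient `F_ε`, and THE BIT -/

section OneBit

variable {R : Type*} [CommRing R]

/-- The functional `φ_ε : Λ³ → Λ`, `(x₀, x₁, x₂) ↦ X x₀ − ε₁ x₁ − ε₂ x₂` exists (used only via `hφ`). -/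
theorem exists_functional (X ε₁ ε₂ : R) :
    ∃ φ : (R × R × R) →ₗ[R] R, ∀ x : R × R × R, φ x = X * x.1 - ε₁ * x.2.1 - ε₂ * x.2.2 := by
  refine ⟨X • LinearMap.fst R R (R × R) - ε₁ • ((LinearMap.fst R R R).comp (LinearMap.snd R R (R × R)))
      - ε₂ • ((LinearMap.snd R R R).comp (LinearMap.snd R R (R × R))), fun x => ?_⟩
  simp [smul_eq_mul]

variable {X ε₁ ε₂ : R} (φ : (R × R × R) →ₗ[R] R)

/-- `φ_ε(h) = X` for `h = (1, 0, 0)`. -/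
theorem apply_h (hφ : ∀ x : R × R × R, φ x = X * x.1 - ε₁ * x.2.1 - ε₂ * x.2.2) :
    φ (1, 0, 0) = X := by
  rw [hφ]; simp

/-- The generator `X ẽ₁ + ε₁ h = (ε₁, X, 0)` of `𝔞L_ε` lies in `ker φ_ε`. -/
theorem apply_rel₁ (hφ : ∀ x : R × R × R, φ x = X * x.1 - ε₁ * x.2.1 - ε₂ * x.2.2) :
    φ (ε₁, X, 0) = 0 := by
  rw [hφ]; simp; ring

/-- The generator `X ẽ₂ + ε₂ h = (ε₂, 0, X)` of `𝔞L_ε` lies in `ker φ_ε`. -/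
theorem apply_rel₂ (hφ : ∀ x : R × R × R, φ x = X * x.1 - ε₁ * x.2.1 - ε₂ * x.2.2) :
    φ (ε₂, 0, X) = 0 := by
  rw [hφ]; simp; ring

/-- `X · ker φ_ε ⊆ ⟨(ε₁, X, 0), (ε₂, 0, X)⟩`: if `X x₀ = ε₁ x₁ + ε₂ x₂` then
`X · (x₀, x₁, x₂) = x₁ · (ε₁, X, 0) + x₂ · (ε₂, 0, X)` (memo §4 robust form: "the relations force
`ē_i = −ε_i h̄/X`"). -/
theorem smul_mem_span_pair_of_apply_eq_zero
    (hφ : ∀ x : R × R × R, φ x = X * x.1 - ε₁ * x.2.1 - ε₂ * x.2.2) (x : R × R × R) (hx : φ x = 0) :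
    X • x ∈ Submodule.span R ({(ε₁, X, 0), (ε₂, 0, X)} : Set (R × R × R)) := by
  obtain ⟨x₀, x₁, x₂⟩ := x
  rw [hφ] at hx
  rw [Submodule.mem_span_pair]
  refine ⟨x₁, x₂, ?_⟩
  simp only [Prod.smul_mk, Prod.mk_add_mk, smul_eq_mul, mul_zero, add_zero, zero_add, Prod.mk.injEq]
  exact ⟨by linear_combination (-1 : R) * hx, mul_comm _ _, mul_comm _ _⟩

/-- `range φ_ε = I_ε = (X, ε₁, ε₂)`. -/
theorem range_eq_span (hφ : ∀ x : R × R × R, φ x = X * x.1 - ε₁ * x.2.1 - ε₂ * x.2.2) :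
    LinearMap.range φ = (Ideal.span {X, ε₁, ε₂} : Submodule R R) := by
  apply le_antisymm
  · rintro _ ⟨x, rfl⟩
    rw [hφ]
    have hX : X ∈ Ideal.span ({X, ε₁, ε₂} : Set R) := Ideal.subset_span (by simp)
    have h₁ : ε₁ ∈ Ideal.span ({X, ε₁, ε₂} : Set R) := Ideal.subset_span (by simp)
    have h₂ : ε₂ ∈ Ideal.span ({X, ε₁, ε₂} : Set R) := Ideal.subset_span (by simp)
    exact Submodule.sub_mem _ (Submodule.sub_mem _ (Ideal.mul_mem_right _ _ hX)
      (Ideal.mul_mem_right _ _ h₁)) (Ideal.mul_mem_right _ _ h₂)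
  · rw [Ideal.span_le]
    rintro r hr
    simp only [Set.mem_insert_iff, Set.mem_singleton_iff] at hr
    rcases hr with rfl | rfl | rfl
    · exact ⟨(1, 0, 0), by rw [hφ]; simp⟩
    · exact ⟨(0, -1, 0), by rw [hφ]; simp⟩
    · exact ⟨(0, 0, -1), by rw [hφ]; simp⟩

/-- **§4 robust form: `F_ε ≃ I_ε`, `[h] ↦ X`.** For `X ≠ 0` and ANY relation module `N ≤ ker φ_ε` containing
`b • (ε₁, X, 0)` and `b • (ε₂, 0, X)` for one `b ≠ 0`, the torsion-free quotient of `Λ³/N` is isomorphic to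
the ideal `I_ε = (X, ε₁, ε₂)`, the class of `x` going to `φ_ε x`, that of `h` to `X` (memo §4: "`F_ε` is
`Λ · h̄/X` if `ε ≠ (0,0)` and `Λ · h̄` if `ε = (0,0)`" — over every domain and without (m3)/(m3′)). -/
theorem exists_torsionFreeQuotient_equiv_span [IsDomain R]
    (hφ : ∀ x : R × R × R, φ x = X * x.1 - ε₁ * x.2.1 - ε₂ * x.2.2) (hX : X ≠ 0)
    (N : Submodule R (R × R × R)) (hN : ∀ x ∈ N, φ x = 0) {b : R} (hb : b ≠ 0)
    (h₁ : b • ((ε₁, X, 0) : R × R × R) ∈ N) (h₂ : b • ((ε₂, 0, X) : R × R × R) ∈ N) :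
    ∃ e : (((R × R × R) ⧸ N) ⧸ Submodule.torsion R ((R × R × R) ⧸ N)) ≃ₗ[R]
        (Ideal.span {X, ε₁, ε₂} : Submodule R R),
      (∀ x : R × R × R, (e (Submodule.Quotient.mk (Submodule.Quotient.mk x)) : R) = φ x) ∧
      (e (Submodule.Quotient.mk (Submodule.Quotient.mk (1, 0, 0))) : R) = X := by
  have hN' : N ≤ LinearMap.ker φ := fun x hx => hN x hx
  have hbN : ∀ x : R × R × R, φ x = 0 → (b * X) • x ∈ N := by
    intro x hx
    obtain ⟨c₁, c₂, hc⟩ := (Submodule.mem_span_pair).1 (smul_mem_span_pair_of_apply_eq_zero φ hφ x hx)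
    rw [mul_smul, ← hc, smul_add, smul_comm b c₁, smul_comm b c₂]
    exact N.add_mem (N.smul_mem c₁ h₁) (N.smul_mem c₂ h₂)
  obtain ⟨e, he⟩ :=
    exists_torsionFreeQuotient_equiv_range φ N hN' (mul_ne_zero hb hX) hbN
  refine ⟨e.trans (LinearEquiv.ofEq _ _ (range_eq_span φ hφ)), fun x => he x, ?_⟩
  change (e (Submodule.Quotient.mk (Submodule.Quotient.mk (1, 0, 0))) : R) = X
  rw [he, apply_h φ hφ]

/-- For `ε = (0,0)`: `I_ε = (X, 0, 0) = (X)`. -/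
theorem span_triple_zero_zero (X : R) : Ideal.span ({X, 0, 0} : Set R) = Ideal.span {X} := by
  simp [Ideal.span_insert, Ideal.span_singleton_eq_bot.2 rfl]

/-- For `ε ≠ (0,0)` with `ε_i ∈ {0,1}`: `I_ε = Λ` (it contains `1`). -/
theorem span_triple_eq_top_of_ne_zero (X : R) {ε₁ ε₂ : R} (h₁ : ε₁ = 0 ∨ ε₁ = 1) (h₂ : ε₂ = 0 ∨ ε₂ = 1)
    (hne : ¬ (ε₁ = 0 ∧ ε₂ = 0)) : Ideal.span ({X, ε₁, ε₂} : Set R) = ⊤ := by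
  rw [Ideal.eq_top_iff_one]
  apply Ideal.subset_span
  rcases h₁ with rfl | rfl
  · rcases h₂ with rfl | rfl
    · exact absurd ⟨rfl, rfl⟩ hne
    · simp
  · simp

/-- **`ε = (0,0)` — BSTW I Prop. 3.11's display FAILS.** The torsion-free quotient `F` of `Λ³/N` is free of
rank one GENERATED BY the class of `h`: `F ≃ Λ` with `[h] ↦ 1` (image of the `𝕋`-line saturated; memo §4
third bullet, robust form `F_(0,0) = Λ · h̄`). -/
theorem exists_equiv_h_eq_one [IsDomain R]
    (hφ : ∀ x : R × R × R, φ x = X * x.1 - ε₁ * x.2.1 - ε₂ * x.2.2) (hX : X ≠ 0)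
    (N : Submodule R (R × R × R)) (hN : ∀ x ∈ N, φ x = 0) {b : R} (hb : b ≠ 0)
    (h₁ : b • ((ε₁, X, 0) : R × R × R) ∈ N) (h₂ : b • ((ε₂, 0, X) : R × R × R) ∈ N)
    (hε : ε₁ = 0 ∧ ε₂ = 0) :
    ∃ e : (((R × R × R) ⧸ N) ⧸ Submodule.torsion R ((R × R × R) ⧸ N)) ≃ₗ[R] R,
      e (Submodule.Quotient.mk (Submodule.Quotient.mk (1, 0, 0))) = 1 := by
  obtain ⟨e, -, heh⟩ := exists_torsionFreeQuotient_equiv_span φ hφ hX N hN hb h₁ h₂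
  obtain ⟨rfl, rfl⟩ := hε
  have hI : (Ideal.span {X, (0 : R), 0} : Submodule R R) = Submodule.span R {X} :=
    span_triple_zero_zero X
  have hv : (e.trans (LinearEquiv.ofEq _ _ hI)) (Submodule.Quotient.mk (Submodule.Quotient.mk (1, 0, 0)))
      = ⟨X, Submodule.mem_span_singleton_self X⟩ := by
    apply Subtype.ext
    rw [LinearEquiv.trans_apply, LinearEquiv.coe_ofEq_apply]
    exact heh
  refine ⟨(e.trans (LinearEquiv.ofEq _ _ hI)).trans (LinearEquiv.coord R R X hX), ?_⟩
  rw [LinearEquiv.trans_apply, hv, LinearEquiv.coord_self]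

/-- **`ε ≠ (0,0)` — BSTW I Prop. 3.11's display HOLDS.** For `ε_i ∈ {0,1}` not both zero: `F ≃ Λ` with
`[h] ↦ X` (free of rank one, `[h] = X ·` a generator) — Prop. 3.11: "`ℍ̂⁻_P ⊗ ℚ̄_p⟦X⟧` mod torsion `≅ ℚ̄_p⟦X⟧`,
image of `𝕋̂⁻_P` `= X · ℚ̄_p⟦X⟧`" (memo §4 first two bullets, `F_ε = Λ · h̄/X`), for ANY `N` as above. -/
theorem exists_equiv_h_eq_X [IsDomain R]
    (hφ : ∀ x : R × R × R, φ x = X * x.1 - ε₁ * x.2.1 - ε₂ * x.2.2) (hX : X ≠ 0)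
    (N : Submodule R (R × R × R)) (hN : ∀ x ∈ N, φ x = 0) {b : R} (hb : b ≠ 0)
    (h₁ : b • ((ε₁, X, 0) : R × R × R) ∈ N) (h₂ : b • ((ε₂, 0, X) : R × R × R) ∈ N)
    (he₁ : ε₁ = 0 ∨ ε₁ = 1) (he₂ : ε₂ = 0 ∨ ε₂ = 1) (hne : ¬ (ε₁ = 0 ∧ ε₂ = 0)) :
    ∃ e : (((R × R × R) ⧸ N) ⧸ Submodule.torsion R ((R × R × R) ⧸ N)) ≃ₗ[R] R,
      e (Submodule.Quotient.mk (Submodule.Quotient.mk (1, 0, 0))) = X := by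
  obtain ⟨e, -, heh⟩ := exists_torsionFreeQuotient_equiv_span φ hφ hX N hN hb h₁ h₂
  have hI : (Ideal.span {X, ε₁, ε₂} : Submodule R R) = ⊤ := span_triple_eq_top_of_ne_zero X he₁ he₂ hne
  refine ⟨(e.trans (LinearEquiv.ofEq _ _ hI)).trans Submodule.topEquiv, ?_⟩
  rw [LinearEquiv.trans_apply, LinearEquiv.trans_apply, Submodule.topEquiv_apply,
    LinearEquiv.coe_ofEq_apply]
  exact heh

/-- **THE BIT (bstw-MEMO-10 (C4)), module form.** For `ε_i ∈ {0,1}`, `X ≠ 0` a NON-UNIT (the uniformiser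
of `ℚ̄_p⟦X⟧`) and any `N` as above: the class of `h` GENERATES the torsion-free quotient `F` of `Λ³/N` IFF
`ε = (0,0)` ("index exactly `(X)` iff `ε ≠ (0,0)`, saturated iff `ε = (0,0)` — all that Prop. 3.11 (ii)–(iv)
consume"; which of `(1,1)`, `(1,0)`, `(0,1)` occurs is invisible at this level). -/
theorem span_h_eq_top_iff [IsDomain R]
    (hφ : ∀ x : R × R × R, φ x = X * x.1 - ε₁ * x.2.1 - ε₂ * x.2.2) (hX : X ≠ 0) (hXu : ¬ IsUnit X)
    (N : Submodule R (R × R × R)) (hN : ∀ x ∈ N, φ x = 0) {b : R} (hb : b ≠ 0)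
    (h₁ : b • ((ε₁, X, 0) : R × R × R) ∈ N) (h₂ : b • ((ε₂, 0, X) : R × R × R) ∈ N)
    (he₁ : ε₁ = 0 ∨ ε₁ = 1) (he₂ : ε₂ = 0 ∨ ε₂ = 1) :
    Submodule.span R {(Submodule.Quotient.mk (Submodule.Quotient.mk ((1, 0, 0) : R × R × R)) :
        ((R × R × R) ⧸ N) ⧸ Submodule.torsion R ((R × R × R) ⧸ N))} = ⊤ ↔ (ε₁ = 0 ∧ ε₂ = 0) := by
  constructor
  · intro hspan
    by_contra hne
    obtain ⟨e, he⟩ := exists_equiv_h_eq_X φ hφ hX N hN hb h₁ h₂ he₁ he₂ hne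
    have h2 := congrArg (Submodule.map (e : _ →ₗ[R] R)) hspan
    rw [Submodule.map_span, Submodule.map_top, LinearEquiv.range, Set.image_singleton,
      LinearEquiv.coe_coe, he] at h2
    exact hXu (Ideal.span_singleton_eq_top.1 h2)
  · intro hε
    obtain ⟨e, he⟩ := exists_equiv_h_eq_one φ hφ hX N hN hb h₁ h₂ hε
    apply Submodule.map_injective_of_injective (f := (e : _ →ₗ[R] R)) e.injective
    rw [Submodule.map_span, Submodule.map_top, LinearEquiv.range, Set.image_singleton,
      LinearEquiv.coe_coe, he]
    exact Ideal.span_singleton_one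

/-- **Index exactly `(X)`.** For `ε ≠ (0,0)`: the span of the class of `h` in the torsion-free quotient
`F` (free of rank one by `exists_equiv_h_eq_X`) is `X • F`; proper when `X` is a non-unit. -/
theorem span_h_eq_smul_top_of_ne_zero [IsDomain R]
    (hφ : ∀ x : R × R × R, φ x = X * x.1 - ε₁ * x.2.1 - ε₂ * x.2.2) (hX : X ≠ 0)
    (N : Submodule R (R × R × R)) (hN : ∀ x ∈ N, φ x = 0) {b : R} (hb : b ≠ 0)
    (h₁ : b • ((ε₁, X, 0) : R × R × R) ∈ N) (h₂ : b • ((ε₂, 0, X) : R × R × R) ∈ N)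
    (he₁ : ε₁ = 0 ∨ ε₁ = 1) (he₂ : ε₂ = 0 ∨ ε₂ = 1) (hne : ¬ (ε₁ = 0 ∧ ε₂ = 0)) :
    Submodule.span R {(Submodule.Quotient.mk (Submodule.Quotient.mk ((1, 0, 0) : R × R × R)) :
        ((R × R × R) ⧸ N) ⧸ Submodule.torsion R ((R × R × R) ⧸ N))} =
      X • (⊤ : Submodule R (((R × R × R) ⧸ N) ⧸ Submodule.torsion R ((R × R × R) ⧸ N))) := by
  obtain ⟨e, he⟩ := exists_equiv_h_eq_X φ hφ hX N hN hb h₁ h₂ he₁ he₂ hne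
  apply Submodule.map_injective_of_injective (f := (e : _ →ₗ[R] R)) e.injective
  rw [Submodule.map_span, Submodule.map_pointwise_smul, Submodule.map_top, LinearEquiv.range,
    Set.image_singleton, LinearEquiv.coe_coe, he, smul_top_eq_span_singleton]

end OneBit

end Summit.BirchSwinnertonDyer.BirchSwinnertonDyer.Theorems.IndexTransfer
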